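import Mathlib
import HarnessLib
import Summits.HubbardSuperconductivity.HubbardSuperconductivity.Theorems.KLProgrammeKLRegimeSplitEvalDerivBounds
import Summits.HubbardSuperconductivity.HubbardSuperconductivity.Theorems.KLProgrammeKLRegimeSplitSymInterpAliasing

/-!
# Route `KLProgramme`, crux K3 — the `symInterp` TOOLKIT, part 5b: the ALIASING BOUND FOR DERIVATIVES of every order
# `‖D^j (evalM (symInterp L (H ∘ latticeMomentum L))) q − D^j H q‖ ≤ 2·aliasTail L c j` for absolutely summable cosine series `H`

Cell gate-hubbard-kl, seat p2 (g6); continues part 5a (`…SymInterpAliasing`: the folding identity `I_L[h_{m,n}] = h_{fold m, fold n}`, the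
folded series, the value-level bound).  Here: with `Σ |c(m,n)|(1+m+n)^J < ∞` both the symbol `cosSeries c ∘ ofLp` and its interpolant
`evalM (symInterp L (cosSeries c ∘ latticeMomentum L))` are differentiated termwise `J` times on `Momentum` (`iteratedFDeriv_tsum_apply`
with the landed `norm_iteratedFDeriv_harmonicM_le : ‖D^j h_{m,n}‖ ≤ (m+n)^j`), the in-band terms cancel exactly and each folded term costs
at most `2|c(m,n)|(m+n)^j`:

* `iteratedFDeriv_cosSeries`, `iteratedFDeriv_evalM_symInterp_cosSeries` (termwise forms);
* **`norm_iteratedFDeriv_evalM_symInterp_sub_cosSeries_le`**: `‖D^j interpolant − D^j symbol‖ ≤ 2·aliasTail L c j` (`j ≤ J`);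
* **`norm_iteratedFDeriv_evalM_symInterp_cosSeries_le`**: `‖D^j interpolant‖ ≤ ‖D^j symbol‖ + 2·aliasTail L c j` — the L-UNIFORM SUP
  CERTIFICATE for interpolants of smooth symbols (the aliasing tail is the tail of a convergent series; it is NOT the Wiener norm of the
  symbol, which is what the `coeffNorm` route converges to);
* `norm_iteratedFDeriv_cosSeries_le` (the Wiener-type bound of the symbol itself, for completeness).

`--supports` the ENGINE child (stmt-HubbardSuperconductivity-19823 and its gen-4 twin): the (E3a-G) sup-Fréchet certificates of
`klFrameExtG`-built pieces (HOME/p2-g6/DELTA-INTERP.md).  Proofs only; nothing is asserted about the model.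
-/

noncomputable section

namespace Summit.HubbardSuperconductivity.HubbardSuperconductivity.Theorems.KLRegimeSplit

set_option linter.dupNamespace false -- summit = problem name (single-conjunct summit), D-0017

open Real Finset Literature.MathematicalPhysics.QuantumLattice Literature.Probability.LatticeModels
open Literature.MathematicalPhysics.QuantumLattice.FermiRG

variable {L : ℕ} [NeZero L]

/-! ## §4 Termwise differentiation and the aliasing bound for DERIVATIVES of every order -/

section Deriv

variable {c : ℕ × ℕ → ℝ} {J : ℕ}

/-- Weighted absolute summability `Σ |c(m,n)|·(1+m+n)^J < ∞` implies plain absolute summability. -/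
theorem summable_abs_of_weighted (hc : Summable fun mn : ℕ × ℕ => |c mn| * (1 + (mn.1 : ℝ) + mn.2) ^ J) :
    Summable fun mn => |c mn| := by
  refine Summable.of_nonneg_of_le (fun _ => abs_nonneg _) (fun mn => ?_) hc
  have h0 : (0 : ℝ) ≤ (mn.1 : ℝ) := Nat.cast_nonneg _
  have h0' : (0 : ℝ) ≤ (mn.2 : ℝ) := Nat.cast_nonneg _
  exact le_mul_of_one_le_right (abs_nonneg _) (one_le_pow₀ (by linarith))

/-- The order-`k` majorants `|c(m,n)|·(a+b)^k` (`a ≤ m`, `b ≤ n`, `k ≤ J`) are summable under the order-`J` weighted summability. -/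
theorem summable_majorant (hc : Summable fun mn : ℕ × ℕ => |c mn| * (1 + (mn.1 : ℝ) + mn.2) ^ J) {a b : ℕ × ℕ → ℕ}
    (ha : ∀ mn, a mn ≤ mn.1) (hb : ∀ mn, b mn ≤ mn.2) {k : ℕ} (hk : k ≤ J) :
    Summable fun mn : ℕ × ℕ => |c mn| * ((a mn : ℝ) + b mn) ^ k := by
  refine Summable.of_nonneg_of_le (fun _ => by positivity) (fun mn => ?_) hc
  refine mul_le_mul_of_nonneg_left ?_ (abs_nonneg _)
  have h1 : ((a mn : ℝ) + b mn) ≤ 1 + (mn.1 : ℝ) + mn.2 := by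
    have := ha mn; have := hb mn
    have h1 : (a mn : ℝ) ≤ mn.1 := by exact_mod_cast ha mn
    have h2 : (b mn : ℝ) ≤ mn.2 := by exact_mod_cast hb mn
    linarith
  have h0 : (0 : ℝ) ≤ (mn.1 : ℝ) := Nat.cast_nonneg _
  have h0' : (0 : ℝ) ≤ (mn.2 : ℝ) := Nat.cast_nonneg _
  have hone : (1 : ℝ) ≤ 1 + (mn.1 : ℝ) + mn.2 := by linarith
  calc ((a mn : ℝ) + b mn) ^ k ≤ (1 + (mn.1 : ℝ) + mn.2) ^ k := pow_le_pow_left₀ (by positivity) h1 k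
    _ ≤ (1 + (mn.1 : ℝ) + mn.2) ^ J := pow_le_pow_right₀ hone hk

/-- **Termwise differentiation of a (possibly index-relabelled) cosine series on `Momentum`**: with `a ≤ m`, `b ≤ n` termwise and
`Σ |c|(1+m+n)^J < ∞`, for every `j ≤ J`,
`D^j (q ↦ Σ' c(m,n) h_{a,b}(q)) = Σ' c(m,n) • D^j h_{a,b}(q)` and the termwise derivatives are summable in norm. -/
theorem iteratedFDeriv_tsum_harmonic (hc : Summable fun mn : ℕ × ℕ => |c mn| * (1 + (mn.1 : ℝ) + mn.2) ^ J) {a b : ℕ × ℕ → ℕ}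
    (ha : ∀ mn, a mn ≤ mn.1) (hb : ∀ mn, b mn ≤ mn.2) {j : ℕ} (hj : j ≤ J) (q : Momentum) :
    iteratedFDeriv ℝ j (fun q : Momentum => ∑' mn : ℕ × ℕ, c mn * TrigPolyC4v.harmonic (a mn) (b mn) (WithLp.ofLp q)) q =
      ∑' mn : ℕ × ℕ, c mn • iteratedFDeriv ℝ j (fun q : Momentum => TrigPolyC4v.harmonic (a mn) (b mn) (WithLp.ofLp q)) q := by
  have hf : ∀ mn : ℕ × ℕ, ContDiff ℝ (J : ℕ∞)
      (fun q : Momentum => c mn * TrigPolyC4v.harmonic (a mn) (b mn) (WithLp.ofLp q)) := fun mn =>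
    contDiff_const.mul (contDiff_harmonicM _ _)
  have hv : ∀ k : ℕ, (k : ℕ∞) ≤ J → Summable fun mn : ℕ × ℕ => |c mn| * ((a mn : ℝ) + b mn) ^ k := fun k hk =>
    summable_majorant hc ha hb (by exact_mod_cast hk)
  have h'f : ∀ (k : ℕ) (mn : ℕ × ℕ) (x : Momentum), (k : ℕ∞) ≤ J →
      ‖iteratedFDeriv ℝ k (fun q : Momentum => c mn * TrigPolyC4v.harmonic (a mn) (b mn) (WithLp.ofLp q)) x‖ ≤
        |c mn| * ((a mn : ℝ) + b mn) ^ k := by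
    intro k mn x _
    have hsm : (fun q : Momentum => c mn * TrigPolyC4v.harmonic (a mn) (b mn) (WithLp.ofLp q)) =
        c mn • fun q : Momentum => TrigPolyC4v.harmonic (a mn) (b mn) (WithLp.ofLp q) := by
      funext q; simp [smul_eq_mul]
    rw [hsm, iteratedFDeriv_const_smul_apply ((contDiff_harmonicM (a mn) (b mn) (k := ((k : ℕ∞) : WithTop ℕ∞))).contDiffAt),
      norm_smul, Real.norm_eq_abs]
    exact mul_le_mul_of_nonneg_left (norm_iteratedFDeriv_harmonicM_le _ _ _ _) (abs_nonneg _)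
  rw [iteratedFDeriv_tsum_apply hf hv h'f (by exact_mod_cast hj) q]
  refine tsum_congr fun mn => ?_
  have hsm : (fun q : Momentum => c mn * TrigPolyC4v.harmonic (a mn) (b mn) (WithLp.ofLp q)) =
      c mn • fun q : Momentum => TrigPolyC4v.harmonic (a mn) (b mn) (WithLp.ofLp q) := by
    funext q; simp [smul_eq_mul]
  rw [hsm, iteratedFDeriv_const_smul_apply ((contDiff_harmonicM (a mn) (b mn) (k := ((j : ℕ∞) : WithTop ℕ∞))).contDiffAt)]

/-- Norm summability of the termwise derivatives. -/
theorem summable_norm_smul_iteratedFDeriv_harmonic (hc : Summable fun mn : ℕ × ℕ => |c mn| * (1 + (mn.1 : ℝ) + mn.2) ^ J)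
    {a b : ℕ × ℕ → ℕ} (ha : ∀ mn, a mn ≤ mn.1) (hb : ∀ mn, b mn ≤ mn.2) {j : ℕ} (hj : j ≤ J) (q : Momentum) :
    Summable fun mn : ℕ × ℕ =>
      ‖c mn • iteratedFDeriv ℝ j (fun q : Momentum => TrigPolyC4v.harmonic (a mn) (b mn) (WithLp.ofLp q)) q‖ := by
  refine Summable.of_nonneg_of_le (fun _ => norm_nonneg _) (fun mn => ?_) (summable_majorant hc ha hb hj)
  rw [norm_smul, Real.norm_eq_abs]
  exact mul_le_mul_of_nonneg_left (norm_iteratedFDeriv_harmonicM_le _ _ _ _) (abs_nonneg _)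

/-- **The symbol's derivatives, termwise**: `D^j (cosSeries c ∘ ofLp)(q) = Σ' c(m,n) • D^j h_{m,n}(q)` for `j ≤ J`. -/
theorem iteratedFDeriv_cosSeries (hc : Summable fun mn : ℕ × ℕ => |c mn| * (1 + (mn.1 : ℝ) + mn.2) ^ J) {j : ℕ} (hj : j ≤ J)
    (q : Momentum) :
    iteratedFDeriv ℝ j (fun q : Momentum => cosSeries c (WithLp.ofLp q)) q =
      ∑' mn : ℕ × ℕ, c mn • iteratedFDeriv ℝ j (fun q : Momentum => TrigPolyC4v.harmonic mn.1 mn.2 (WithLp.ofLp q)) q :=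
  iteratedFDeriv_tsum_harmonic hc (fun _ => le_rfl) (fun _ => le_rfl) hj q

/-- **The interpolant's derivatives, termwise**: `D^j (evalM (symInterp L (cosSeries c ∘ latticeMomentum L)))(q) = Σ' c(m,n) • D^j h_{fold m, fold n}(q)`. -/
theorem iteratedFDeriv_evalM_symInterp_cosSeries (hc : Summable fun mn : ℕ × ℕ => |c mn| * (1 + (mn.1 : ℝ) + mn.2) ^ J) {j : ℕ}
    (hj : j ≤ J) (q : Momentum) :
    iteratedFDeriv ℝ j (evalM (symInterp L (fun k => cosSeries c (latticeMomentum L k)))) q =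
      ∑' mn : ℕ × ℕ, c mn • iteratedFDeriv ℝ j
        (fun q : Momentum => TrigPolyC4v.harmonic (foldFreq L mn.1) (foldFreq L mn.2) (WithLp.ofLp q)) q := by
  have hfun : evalM (symInterp L (fun k => cosSeries c (latticeMomentum L k))) =
      fun q : Momentum => ∑' mn : ℕ × ℕ, c mn * TrigPolyC4v.harmonic (foldFreq L mn.1) (foldFreq L mn.2) (WithLp.ofLp q) := by
    funext q
    exact eval_symInterp_cosSeries (summable_abs_of_weighted hc) (WithLp.ofLp q)
  rw [hfun]
  exact iteratedFDeriv_tsum_harmonic hc (fun mn => foldFreq_le mn.1) (fun mn => foldFreq_le mn.2) hj q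

omit [NeZero L] in
/-- The aliasing tail is the `tsum` of a summable nonnegative family (under the order-`J` weighted summability, `j ≤ J`). -/
theorem summable_aliasTail_term (L : ℕ) (hc : Summable fun mn : ℕ × ℕ => |c mn| * (1 + (mn.1 : ℝ) + mn.2) ^ J) {j : ℕ} (hj : j ≤ J) :
    Summable fun mn : ℕ × ℕ => if (L / 2 < mn.1 ∨ L / 2 < mn.2) then |c mn| * ((mn.1 : ℝ) + mn.2) ^ j else 0 := by
  refine Summable.of_nonneg_of_le (fun mn => ?_) (fun mn => ?_) (summable_majorant hc (fun _ => le_rfl) (fun _ => le_rfl) hj)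
  · split_ifs <;> positivity
  · split_ifs
    · exact le_rfl
    · positivity

/-- **THE ALIASING BOUND FOR DERIVATIVES.**  For an absolutely summable cosine series `H = cosSeries c` with `Σ |c|(1+m+n)^J < ∞` and
every `j ≤ J`, at every `q`:
`‖D^j (evalM (symInterp L (H ∘ latticeMomentum L))) q − D^j (H ∘ ofLp) q‖ ≤ 2 · aliasTail L c j`
— the in-band terms cancel exactly (`foldFreq = id` there), each folded term costs `(fold m + fold n)^j + (m+n)^j ≤ 2(m+n)^j`. -/
theorem norm_iteratedFDeriv_evalM_symInterp_sub_cosSeries_le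
    (hc : Summable fun mn : ℕ × ℕ => |c mn| * (1 + (mn.1 : ℝ) + mn.2) ^ J) {j : ℕ} (hj : j ≤ J) (q : Momentum) :
    ‖iteratedFDeriv ℝ j (evalM (symInterp L (fun k => cosSeries c (latticeMomentum L k)))) q -
        iteratedFDeriv ℝ j (fun q : Momentum => cosSeries c (WithLp.ofLp q)) q‖ ≤ 2 * aliasTail L c j := by
  rw [iteratedFDeriv_evalM_symInterp_cosSeries hc hj, iteratedFDeriv_cosSeries hc hj, aliasTail]
  have hs1 := (summable_norm_smul_iteratedFDeriv_harmonic hc (fun mn => foldFreq_le (L := L) mn.1)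
    (fun mn => foldFreq_le (L := L) mn.2) hj q)
  have hs2 := (summable_norm_smul_iteratedFDeriv_harmonic hc (fun _ => le_rfl) (fun _ => le_rfl) hj q)
  have hs1' := hs1.of_norm
  have hs2' := hs2.of_norm
  rw [← hs1'.tsum_sub hs2']
  have hterm : ∀ mn : ℕ × ℕ,
      ‖c mn • iteratedFDeriv ℝ j (fun q : Momentum => TrigPolyC4v.harmonic (foldFreq L mn.1) (foldFreq L mn.2) (WithLp.ofLp q)) q -
        c mn • iteratedFDeriv ℝ j (fun q : Momentum => TrigPolyC4v.harmonic mn.1 mn.2 (WithLp.ofLp q)) q‖ ≤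
      2 * (if (L / 2 < mn.1 ∨ L / 2 < mn.2) then |c mn| * ((mn.1 : ℝ) + mn.2) ^ j else 0) := by
    intro mn
    split_ifs with h
    · rw [← smul_sub, norm_smul, Real.norm_eq_abs]
      have h1 := norm_iteratedFDeriv_harmonicM_le (foldFreq L mn.1) (foldFreq L mn.2) j q
      have h2 := norm_iteratedFDeriv_harmonicM_le mn.1 mn.2 j q
      have hf1 : ((foldFreq L mn.1 : ℝ) + foldFreq L mn.2) ^ j ≤ ((mn.1 : ℝ) + mn.2) ^ j := by
        refine pow_le_pow_left₀ (by positivity) ?_ j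
        have e1 : (foldFreq L mn.1 : ℝ) ≤ mn.1 := by exact_mod_cast foldFreq_le mn.1
        have e2 : (foldFreq L mn.2 : ℝ) ≤ mn.2 := by exact_mod_cast foldFreq_le mn.2
        linarith
      have h3 := norm_sub_le
        (iteratedFDeriv ℝ j (fun q : Momentum => TrigPolyC4v.harmonic (foldFreq L mn.1) (foldFreq L mn.2) (WithLp.ofLp q)) q)
        (iteratedFDeriv ℝ j (fun q : Momentum => TrigPolyC4v.harmonic mn.1 mn.2 (WithLp.ofLp q)) q)
      nlinarith [abs_nonneg (c mn)]
    · push Not at h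
      rw [foldFreq_of_le_half h.1, foldFreq_of_le_half h.2, sub_self, norm_zero, mul_zero]
  have hsum : Summable fun mn : ℕ × ℕ => 2 * (if (L / 2 < mn.1 ∨ L / 2 < mn.2) then |c mn| * ((mn.1 : ℝ) + mn.2) ^ j else 0) :=
    (summable_aliasTail_term L hc hj).mul_left 2
  have hsn : Summable fun mn : ℕ × ℕ => ‖c mn • iteratedFDeriv ℝ j
        (fun q : Momentum => TrigPolyC4v.harmonic (foldFreq L mn.1) (foldFreq L mn.2) (WithLp.ofLp q)) q -
      c mn • iteratedFDeriv ℝ j (fun q : Momentum => TrigPolyC4v.harmonic mn.1 mn.2 (WithLp.ofLp q)) q‖ :=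
    Summable.of_nonneg_of_le (fun _ => norm_nonneg _) (fun mn => norm_sub_le _ _) (hs1.add hs2)
  calc ‖∑' mn : ℕ × ℕ, (c mn • iteratedFDeriv ℝ j
            (fun q : Momentum => TrigPolyC4v.harmonic (foldFreq L mn.1) (foldFreq L mn.2) (WithLp.ofLp q)) q -
          c mn • iteratedFDeriv ℝ j (fun q : Momentum => TrigPolyC4v.harmonic mn.1 mn.2 (WithLp.ofLp q)) q)‖
      ≤ ∑' mn : ℕ × ℕ, ‖c mn • iteratedFDeriv ℝ j
            (fun q : Momentum => TrigPolyC4v.harmonic (foldFreq L mn.1) (foldFreq L mn.2) (WithLp.ofLp q)) q -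
          c mn • iteratedFDeriv ℝ j (fun q : Momentum => TrigPolyC4v.harmonic mn.1 mn.2 (WithLp.ofLp q)) q‖ :=
        norm_tsum_le_tsum_norm hsn
    _ ≤ ∑' mn : ℕ × ℕ, 2 * (if (L / 2 < mn.1 ∨ L / 2 < mn.2) then |c mn| * ((mn.1 : ℝ) + mn.2) ^ j else 0) :=
        Summable.tsum_le_tsum hterm hsn hsum
    _ = 2 * ∑' mn : ℕ × ℕ, (if (L / 2 < mn.1 ∨ L / 2 < mn.2) then |c mn| * ((mn.1 : ℝ) + mn.2) ^ j else 0) := tsum_mul_left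

/-- **COROLLARY (the L-uniform sup certificate)**: the interpolant's `j`-th derivative is the symbol's plus twice the aliasing tail,
`‖D^j (evalM (symInterp L (H ∘ latticeMomentum L))) q‖ ≤ ‖D^j (H ∘ ofLp) q‖ + 2 · aliasTail L c j` (`j ≤ J`). -/
theorem norm_iteratedFDeriv_evalM_symInterp_cosSeries_le
    (hc : Summable fun mn : ℕ × ℕ => |c mn| * (1 + (mn.1 : ℝ) + mn.2) ^ J) {j : ℕ} (hj : j ≤ J) (q : Momentum) :
    ‖iteratedFDeriv ℝ j (evalM (symInterp L (fun k => cosSeries c (latticeMomentum L k)))) q‖ ≤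
      ‖iteratedFDeriv ℝ j (fun q : Momentum => cosSeries c (WithLp.ofLp q)) q‖ + 2 * aliasTail L c j := by
  have h := norm_iteratedFDeriv_evalM_symInterp_sub_cosSeries_le (L := L) hc hj q
  have htri := norm_le_insert'
    (iteratedFDeriv ℝ j (evalM (symInterp L (fun k => cosSeries c (latticeMomentum L k)))) q)
    (iteratedFDeriv ℝ j (fun q : Momentum => cosSeries c (WithLp.ofLp q)) q)
  linarith

/-- **The symbol's derivative bound from the coefficients** (for completeness; this is the Wiener-type bound, sharp only for symbols
without fine structure): `‖D^j (cosSeries c ∘ ofLp) q‖ ≤ Σ' |c(m,n)|·(m+n)^j`. -/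
theorem norm_iteratedFDeriv_cosSeries_le (hc : Summable fun mn : ℕ × ℕ => |c mn| * (1 + (mn.1 : ℝ) + mn.2) ^ J) {j : ℕ}
    (hj : j ≤ J) (q : Momentum) :
    ‖iteratedFDeriv ℝ j (fun q : Momentum => cosSeries c (WithLp.ofLp q)) q‖ ≤
      ∑' mn : ℕ × ℕ, |c mn| * ((mn.1 : ℝ) + mn.2) ^ j := by
  rw [iteratedFDeriv_cosSeries hc hj]
  have hs := summable_norm_smul_iteratedFDeriv_harmonic hc (fun _ => le_rfl) (fun _ => le_rfl) hj q
  refine (norm_tsum_le_tsum_norm hs).trans (Summable.tsum_le_tsum (fun mn => ?_) hs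
    (summable_majorant hc (fun _ => le_rfl) (fun _ => le_rfl) hj))
  rw [norm_smul, Real.norm_eq_abs]
  exact mul_le_mul_of_nonneg_left (norm_iteratedFDeriv_harmonicM_le _ _ _ _) (abs_nonneg _)

end Deriv

end Summit.HubbardSuperconductivity.HubbardSuperconductivity.Theorems.KLRegimeSplit

end
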